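import Summits.AtomisticToContinuum.FouriersLaw.Theorems.BondHeatUncertaintyExtensiveSnapshotIrreversibilityEnergyWindowSmoothDuhamel
import Literature.MathematicalPhysics.KineticTheory.PhaseSpacePoisson

/-!
(SPLIT FOR THE 400-LINE CAP by the landing lane, hand-2 g33: this file = part 1 of 3; sequels `…BondHeatUncertaintyExtensiveSnapshotIrreversibilityEnergyWindowDilationDuhamelB`, `…BondHeatUncertaintyExtensiveSnapshotIrreversibilityEnergyWindowDilationDuhamel` import it in a chain; same namespace, all FQNs unchanged.)
# Crux `ExtensiveSnapshotIrreversibility` (stmt-AtomisticToContinuum-9121): the dilation Duhamel —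
# the order-two layer beneath S3 removed by an exact commutator identity

Cell decomp-a2c, lens «grading / quantitative ladder», generation 86, part W «DilationDuhamel».
The record of row 1218 beneath the kernel leaf S3 `KernelTemperatureLipschitz` is
`S3 ⟸ (Dˢ) ∧ (MC∞)[PROVED] ∧ (RW₁)[order 1, ATTACKABLE-L] ∧ (SD₂)|(MC∞)[order 2, RESIDUAL·XL]`:
the Duhamel formula `P^δ_1 − P^0_1 = (γδ/2) ∫₀¹ P^δ_s (∂²_{p_L} − ∂²_{p_R}) P^0_{1−s} ds` carries a
SECOND-order momentum derivative, and every split of it (Bismut half × IBP half, (G2)/(G2*),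
(KD₂), (MD₂) ⟺ (SD₁) ∧ (SD₂)) leaves a genuinely second-order density estimate, (SD₂) = score
orders `{1, 3}`, whose native proof needs second Malliavin derivatives and the third variation of
the flow (g85 memo).  THIS FILE RE-GRADES THE DUHAMEL ITSELF so that no second-order quantity is
ever estimated.

THE IDENTITY (§1, PROVED for every chain with smooth potentials, every site `b`, smooth `f`):

  `[L, D_b] f = 2γ c_b ∂²_{p_b} f − 𝒜_b f`,   `D_b f := p_b ∂_{p_b} f` (momentum DILATION),
  `𝒜_b f := p_b ∂_{q_b} f + (∂_{q_b}H) ∂_{p_b} f` (bath EXCHANGE operator, FIRST order),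
  `c_b = [b = 0] T_L + [b = N−1] T_R` (`generator_momDilation_sub`).

(The friction `−γ p_b ∂_{p_b}` commutes with `D_b`; the noise gives `[T ∂²_p, p ∂_p] = 2T ∂²_p` —
a temperature change IS a momentum rescaling of the Ornstein–Uhlenbeck bath; the Hamiltonian
field `Y_H` gives `[Y_H·∇, D_b] = −𝒜_b`.)  Since `L^{T_L,T_R}` is affine in the temperatures,
`∂_δ L^{T+δ/2, T−δ/2} = (γ/2)(∂²_{p_L} − ∂²_{p_R})
  = (4T_L)⁻¹ ([L, D_L] + 𝒜_L) − (4T_R)⁻¹ ([L, D_R] + 𝒜_R)` (`hasDerivAt_generator_temperature`,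
★ `generator_temperature_deriv_eq_dilation`, ★ `hasDerivAt_generator_temperature_dilation`:
the infinitesimal form, PROVED).  Integrating along the HOMOGENEOUS `δ'`-semigroup (Duhamel in
the temperature parameter, both factors the SAME chain) the commutator TELESCOPES,
`∫₀¹ P_s [L, D_b] P_{1−s} ds = P_1 D_b − D_b P_1`, whence the DILATION DUHAMEL

  `∂_{δ'} P^{δ'}_1 h(z) = Σ_{b ∈ {L,R}} ± (4T_b(δ'))⁻¹ { P_1(p_b ∂_{p_b} h)(z)
      − z_{p_b} ∂_{p_b}(P_1 h)(z) + ∫₀¹ P_s (𝒜_b P_{1−s} h)(z) ds }`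
  (all kernels those of the `δ'`-chain).

EVERY TERM IS OF FIRST ORDER: an arrival derivative at time 1 (test function `p_b h ∈ C_c^∞`), a
departure derivative at time 1, and first derivatives of `u_{1−s} = P_{1−s} h` at the bath site —
read as departure derivatives at times `1−s ∈ [½, 1)` on the near half `s ≤ ½` and, after one
integration by parts onto `P_s(z, ·)`, as arrival derivatives at times `s ∈ [½, 1]` on the far
half (both inside the window `[½, 1]` of the proved Gram-limit input (MC∞); no rate, no singular
`s`-integral).  The one new feature is the POSITION direction `q_b` (from `p_b ∂_{q_b}`) next to
the momentum direction `p_b`: order-1 duals in direction `e_{q_b}` at the two bath sites, covered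
by the same full `2N × 2N` skeleton Gram matrix.

PIECES (§3; all for `h ∈ C_c^∞`, `|h| ≤ e^{θH}`, uniformly in `|δ| < δ₀`, weights
`e^{θH} → e^{θ'H}`):
* (Dᵛ)  `KernelTemperatureDilationDuhamel` — the displayed derivative formula [INSTRUMENTABLE:
  (Dˢ) with a general base temperature + weak continuity of the kernel in the temperature +
  Dynkin for the polynomially weighted smooth test functions `D_b u`, i.e. the hands' (Dˢ)
  toolset; its generator-level content is PROVED here].
* (EBᵃ) `DilationArrivalBound`, (EBᵈ) `DilationDepartureBound` — the two time-1 endpoint terms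
  [order 1 · momentum direction · ⟸ (SD₁) orders {2} resp. {0} at `s = 1` + CEHR (3.4)].
* (XBⁿ) `ExchangeTermBoundNear` (`s ∈ (0, ½]`), (XBᶠ) `ExchangeTermBoundFar` (`s ∈ [½, 1]`) — the
  exchange integrand [order 1 · directions `p_b` AND `q_b` · near ⟸ departure duals on `[½,1)` +
  differentiation under `∫` + Hölder/CEHR; far ⟸ arrival duals on `[½,1]` + truncation IBP
  (pattern `perturbedKernelHessianIBP_of_compact`)].
* ★★ `kernelTemperatureLipschitzSmooth_of_dilation : (Dᵛ) → (EBᵃ) → (EBᵈ) → (XBⁿ) → (XBᶠ) → S3ˢ`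
  PROVED by the mean-value inequality on `δ' ↦ P^{δ'}_1 h(z)` over `(−δ₀, δ₀)` (no Fubini, no
  integrability bookkeeping: `‖∫₀¹ X‖ ≤ sup ‖X‖`), hence S3 (`kernelTemperatureLipschitz_of_smooth`)
  and the junction `K_fix ⟸ A0 ∧ A2 ∧ (Dᵛ) ∧ (EBᵃ) ∧ (EBᵈ) ∧ (XBⁿ) ∧ (XBᶠ) ∧ A3p ∧ A4`
  (`snapshotKLUpperExpansion_of_atoms₉V`).

WHAT IS BYPASSED, NOT PROVED: (SD₂) `DensityScoreDualBoundSecond`, (KD₂), (G2), (G2*), (MW₂) — no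
second derivative of a density or of an orbit occurs anywhere on this line.  WHY HOMOGENEITY IS
ESSENTIAL: on the fixed-base pair `(δ, 0)` of (Dˢ) the commutator does not telescope
(`P^δ_s [L^δ, D] P^0_{1−s}` vs. `∂_s` of `P^δ_s D P^0_{1−s}` differ by
`P^δ_s D (L^δ − L^0) P^0_{1−s}`, second order again); differentiating in the temperature at a
VARIABLE base makes both factors the same semigroup.  CHOICE OF CONJUGATOR: the full site dilation
`p_b ∂_{p_b} + q_b ∂_{q_b}` would leave only momentum derivatives in the interior but at the sites
`b, b ± 1` AND position derivatives at the time-1 endpoints; `D_b = p_b ∂_{p_b}` costs exactly one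
new direction (`q_b` at the bath sites, inside the window).  No new objects beyond the
abbreviations of §2.

Calibration: for one Ornstein–Uhlenbeck momentum (`U = V = 0`, `h = h(p)`, so `𝒜 u = 0`) both
sides of (Dᵛ) equal `σ₁ E[ξ h′(p e^{−γ} + σ₁ ξ)]/(2T)`, `σ₁² = T(1 − e^{−2γ})`.

References: N. Cuneo, J.-P. Eckmann, M. Hairer, L. Rey-Bellet, Electron. J. Probab. 23 (2018)
no. 55, §3 (3.2)–(3.4); D. Bakry, M. Émery, Séminaire de Probabilités XIX, LNM 1123 (1985)
177–206 (carré du champ `Γ(f,g) = ½(L(fg) − fLg − gLf)`; here `2Γ(p_b, ·) = 2γT_b ∂_{p_b}`);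
E. Fournié, J.-M. Lasry, J. Lebuchoux, P.-L. Lions, N. Touzi, Finance Stoch. 3 (1999) 391–412,
Prop. 3.3 (sensitivity to the diffusion coefficient reduced to first-order weights);
K.-J. Engel, R. Nagel, One-Parameter Semigroups for Linear Evolution Equations (2000), §III.1
(bounded perturbation / Duhamel, `∫₀ᵗ T(t−s)[B, ·]T(s)` identities); S. Cerrai, Second Order
PDE's in Finite and Infinite Dimension, LNM 1762 (2001), §1.3.
-/

noncomputable section

namespace Summit.AtomisticToContinuum.FouriersLaw.Theorems.ExtensiveSnapshotIrreversibility.EnergyWindow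

open MeasureTheory Filter Topology Real intervalIntegral
open scoped ENNReal NNReal ContDiff
open Literature.MathematicalPhysics.KineticTheory.HeatConduction
open Literature.Probability.Process

variable {N : ℕ}

/-! ## 1. The dilation commutator identity at the level of the generator -/

/-- The **momentum dilation** at site `b`: `D_b f := p_b ∂_{p_b} f` (the generator of the scaling
`p_b ↦ e^τ p_b`). [folklore] -/
def momDilation (b : Fin N) (f : PhaseSpace N → ℝ) : PhaseSpace N → ℝ :=
  fun x => x.2 b * partialP b f x

/-- The **bath exchange operator** at site `b`: `𝒜_b f := p_b ∂_{q_b} f + (∂_{q_b}H) ∂_{p_b} f`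
(FIRST order; coefficients `p_b` and `∂_{q_b}H`, i.e. `Y_{H,b} + 2 (∂_{q_b}H) ∂_{p_b}` with
`Y_{H,b}` the site-`b` part of the Hamiltonian field). [folklore] -/
def bathExchange (P : OscillatorChain) (N : ℕ) (b : Fin N) (f : PhaseSpace N → ℝ) :
    PhaseSpace N → ℝ :=
  fun x => x.2 b * partialQ b f x + partialQ b (P.hamiltonian N) x * partialP b f x

/-- The bath coefficient `c_i(T_L, T_R) = [i = 0] T_L + [i = N−1] T_R` of `γ ∂²_{p_i}` in the
generator (`generator_eq_fderiv_drift_add`). [folklore] -/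
def bathCoeff (N : ℕ) (T_L T_R : ℝ) (i : Fin N) : ℝ :=
  (if i.val = 0 then T_L else 0) + (if i.val = N - 1 then T_R else 0)

/-- `∂_{p_i} p_j = [j = i]`. [folklore] -/
theorem partialP_momentum_coord (i j : Fin N) (x : PhaseSpace N) :
    partialP i (fun y : PhaseSpace N => y.2 j) x = if j = i then 1 else 0 := by
  unfold partialP
  by_cases h : j = i
  · subst h; simp
  · simp [h]

/-- The momentum coordinate `x ↦ p_j` is smooth. [folklore] -/
theorem contDiff_momentum_coord (j : Fin N) : ContDiff ℝ ∞ (fun y : PhaseSpace N => y.2 j) :=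
  (contDiff_apply ℝ ℝ j).comp contDiff_snd

/-- `D(p_j)(x) v = v_{p_j}`. [folklore] -/
theorem fderiv_momentum_coord (j : Fin N) (x v : PhaseSpace N) :
    fderiv ℝ (fun y : PhaseSpace N => y.2 j) x v = v.2 j := by
  have : (fun y : PhaseSpace N => y.2 j) =
      ⇑((ContinuousLinearMap.proj j).comp (ContinuousLinearMap.snd ℝ (Fin N → ℝ) (Fin N → ℝ))) :=
    rfl
  rw [this, ContinuousLinearMap.fderiv]
  rfl

/-- **Clairaut in coordinates**: `∂_{p_i} ∂_{p_j} f = ∂_{p_j} ∂_{p_i} f` for `f ∈ C²`. [folklore] -/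
theorem partialP_partialP_swap {f : PhaseSpace N → ℝ} (hf : ContDiff ℝ 2 f) (i j : Fin N) :
    partialP i (partialP j f) = partialP j (partialP i f) := by
  have hd : Differentiable ℝ f := hf.differentiable (by norm_num)
  have h1 : ∀ k : Fin N, Differentiable ℝ (partialP k f) := fun k =>
    (contDiff_partialP (m := 1) hf (by norm_num) k).differentiable one_ne_zero
  funext x
  rw [partialP_eq_fderiv (h1 j) i, partialP_eq_fderiv (h1 i) j]
  simp only
  rw [partialP_eq_fderiv hd j, partialP_eq_fderiv hd i,
    (hasFDerivAt_fderiv_apply hf x _).fderiv, (hasFDerivAt_fderiv_apply hf x _).fderiv]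
  simp only [ContinuousLinearMap.flip_apply]
  exact fderiv_fderiv_symm hf x _ _

-- (landing lane, hand-2 g33: the lambda-form additivity lemma `partialP_fun_add₂` of the seat file is the tree theorem
-- `Summit.AtomisticToContinuum.FouriersLaw.Theorems.OddSectorIrreversibility.partialP_add` (dedup); its uses below and in the sequels cite that name.)

/-- `∂_{p_b} Σ_i F_i = Σ_i ∂_{p_b} F_i` for differentiable summands. [folklore] -/
theorem partialP_fun_sum {ι : Type*} (s : Finset ι) {F : ι → PhaseSpace N → ℝ}
    (hF : ∀ i, Differentiable ℝ (F i)) (b : Fin N) (x : PhaseSpace N) :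
    partialP b (fun y => ∑ i ∈ s, F i y) x = ∑ i ∈ s, partialP b (F i) x := by
  classical
  induction s using Finset.induction_on with
  | empty => simp [partialP]
  | insert a s ha ih =>
    simp only [Finset.sum_insert ha]
    rw [Summit.AtomisticToContinuum.FouriersLaw.Theorems.OddSectorIrreversibility.partialP_add (hF a) (by fun_prop) b x, ih]

/-- `Σ_i c_i(a, c) K_i = a K_{left} + c K_{right}` (`N ≥ 2`). [folklore] -/
theorem sum_bathCoeff_mul (hN : 2 ≤ N) (a c : ℝ) (K : Fin N → ℝ) :
    ∑ i, bathCoeff N a c i * K i = a * K (leftBath N hN) + c * K (rightBath N hN) := by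
  simp only [bathCoeff, add_mul, Finset.sum_add_distrib, ite_mul, zero_mul]
  congr 1
  · rw [Finset.sum_eq_single (leftBath N hN)]
    · simp [leftBath]
    · intro i _ hi
      have : i.val ≠ 0 := fun h0 => hi (Fin.ext (by simp [leftBath, h0]))
      simp [this]
    · simp
  · rw [Finset.sum_eq_single (rightBath N hN)]
    · simp [rightBath]
    · intro i _ hi
      have : i.val ≠ N - 1 := fun h0 => hi (Fin.ext (by simp [rightBath, h0]))
      simp [this]
    · simp

/-- The generator is AFFINE in the bath temperatures:
`L^{T_L,T_R} f = L^{0,0} f + γ Σ_i c_i(T_L,T_R) ∂²_{p_i} f` (no hypothesis on `f`). [folklore] -/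
theorem generator_eq_generator_zero_add (P : OscillatorChain) (N : ℕ) (T_L T_R : ℝ)
    (f : PhaseSpace N → ℝ) (x : PhaseSpace N) :
    P.generator N T_L T_R f x = P.generator N 0 0 f x +
      P.γ * ∑ i, bathCoeff N T_L T_R i * partialP i (partialP i f) x := by
  simp only [OscillatorChain.generator, bathCoeff]
  rw [add_assoc, ← mul_add, ← Finset.sum_add_distrib]
  congr 1
  congr 1
  refine Finset.sum_congr rfl fun i _ => ?_
  split_ifs <;> ring

/-- **`∂_δ L^{T+δ/2, T−δ/2} f = (γ/2)(∂²_{p_L} − ∂²_{p_R}) f`**, written as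
`γ Σ_i c_i(½, −½) ∂²_{p_i} f` (no hypothesis on `f`: the generator is affine in the
temperatures). [folklore] -/
theorem hasDerivAt_generator_temperature (P : OscillatorChain) (N : ℕ) (T : ℝ)
    (f : PhaseSpace N → ℝ) (x : PhaseSpace N) (δ' : ℝ) :
    HasDerivAt (fun δ => P.generator N (T + δ / 2) (T - δ / 2) f x)
      (P.γ * ∑ i, bathCoeff N (1 / 2) (-1 / 2) i * partialP i (partialP i f) x) δ' := by
  have hc : ∀ δ i, bathCoeff N (T + δ / 2) (T - δ / 2) i =
      bathCoeff N T T i + δ * bathCoeff N (1 / 2) (-1 / 2) i := fun δ i => by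
    simp only [bathCoeff]; split_ifs <;> ring
  have hfun : (fun δ => P.generator N (T + δ / 2) (T - δ / 2) f x) = fun δ =>
      (P.generator N 0 0 f x + P.γ * ∑ i, bathCoeff N T T i * partialP i (partialP i f) x) +
        δ * (P.γ * ∑ i, bathCoeff N (1 / 2) (-1 / 2) i * partialP i (partialP i f) x) := by
    funext δ
    rw [generator_eq_generator_zero_add]
    simp only [hc δ, add_mul, Finset.sum_add_distrib, mul_add, Finset.mul_sum]
    ring_nf
  rw [hfun]
  simpa using ((hasDerivAt_id δ').mul_const
    (P.γ * ∑ i, bathCoeff N (1 / 2) (-1 / 2) i * partialP i (partialP i f) x)).const_add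
    (P.generator N 0 0 f x + P.γ * ∑ i, bathCoeff N T T i * partialP i (partialP i f) x)

end Summit.AtomisticToContinuum.FouriersLaw.Theorems.ExtensiveSnapshotIrreversibility.EnergyWindow

end
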